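import Mathlib

/-!
# `FeketeSOS.SublinearShadow` (stmt-ValiantsHypothesis-14990), line `Sketch`, reshape 5 — stub `stub_symmCongruenceDiag`

**Complex symmetric matrices are congruent to diagonal matrices.**  A complex quadratic syzygy
`Σ_{j,j'} ν_{jj'} g_j g_{j'} = 0` among the sparse polynomials of a representation is given by a symmetric
matrix `ν`; the assembly (`syzygyFree_three`) diagonalises it as `ν = Eᵀ · diag(w) · E` with `E` invertible,
so that the syzygy reads `Σ_l w_l z_l² = 0` for `z = E · g`.  This file proves the classical fact behind
that step: a symmetric bilinear form over a field of characteristic `≠ 2` has an orthogonal basis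
(Mathlib's `LinearMap.BilinForm.exists_orthogonal_basis`), translated into matrix language via the
change-of-basis formula `LinearMap.BilinForm.toMatrix_mul_basis_toMatrix`.
-/

namespace Summit.ValiantsHypothesis.ValiantsHypothesis.Theorems.SublinearShadowSketch

open Polynomial Finset IsLocalRing Matrix

-- `Summit.ValiantsHypothesis.ValiantsHypothesis.…` is the tree's mandated single-conjunct layout (Sub = Summit).
set_option linter.dupNamespace false

/-- The Gram matrix of a bilinear form in an orthogonal family is the diagonal matrix of the
self-pairings. -/
theorem scd_toMatrix_of_isOrthoFamily {ι : Type*} [Fintype ι] [DecidableEq ι]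
    {V : Type*} [AddCommGroup V] [Module ℂ V] (B : LinearMap.BilinForm ℂ V)
    (c : Module.Basis ι ℂ V) (hc : B.IsOrthoᵢ c) :
    LinearMap.BilinForm.toMatrix c B = Matrix.diagonal fun i => B (c i) (c i) := by
  ext i j
  rw [LinearMap.BilinForm.toMatrix_apply, Matrix.diagonal_apply]
  split_ifs with h
  · subst h
    rfl
  · exact hc h

/-- **Congruence diagonalisation of complex symmetric matrices.**  Every symmetric matrix
`ν ∈ M_n(ℂ)` can be written as `ν = Eᵀ * diagonal w * E` with `E` invertible (`IsUnit E.det`):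
the symmetric bilinear form `x ↦ y ↦ xᵀ ν y` has an orthogonal basis `c` (characteristic `≠ 2`),
`Pᵀ ν P` is diagonal for the matrix `P` of `c` in the standard basis, and `E = P⁻¹`. -/
theorem stub_symmCongruenceDiag (n : ℕ) (ν : Matrix (Fin n) (Fin n) ℂ) (hsym : ν.IsSymm) :
    ∃ (E : Matrix (Fin n) (Fin n) ℂ) (w : Fin n → ℂ), IsUnit E.det ∧ ν = Eᵀ * Matrix.diagonal w * E := by
  classical
  letI : Invertible (2 : ℂ) := invertibleOfNonzero two_ne_zero
  set B : LinearMap.BilinForm ℂ (Fin n → ℂ) := Matrix.toBilin' ν with hB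
  have hBsym : B.IsSymm := Matrix.isSymm_toBilin'_iff_isSymm.mpr hsym
  obtain ⟨v, hv⟩ :=
    LinearMap.BilinForm.exists_orthogonal_basis (LinearMap.BilinForm.isSymm_iff.1 hBsym)
  set e : Fin (Module.finrank ℂ (Fin n → ℂ)) ≃ Fin n := finCongr (Module.finrank_fin_fun ℂ)
  set c : Module.Basis (Fin n) ℂ (Fin n → ℂ) := v.reindex e with hcdef
  have hc : B.IsOrthoᵢ c := by
    intro i j hij
    have hij' : e.symm i ≠ e.symm j := fun h => hij (e.symm.injective h)
    simpa only [hcdef, Function.onFun, Module.Basis.reindex_apply] using hv hij'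
  set b : Module.Basis (Fin n) ℂ (Fin n → ℂ) := Pi.basisFun ℂ (Fin n) with hbdef
  have hflip : b.toMatrix c * c.toMatrix b = 1 := b.toMatrix_mul_toMatrix_flip c
  have hνB : LinearMap.BilinForm.toMatrix b B = ν := by
    rw [hbdef, LinearMap.BilinForm.toMatrix_basisFun, hB, LinearMap.BilinForm.toMatrix'_toBilin']
  have hdiag : (b.toMatrix c)ᵀ * ν * b.toMatrix c = Matrix.diagonal fun i => B (c i) (c i) := by
    rw [← hνB, LinearMap.BilinForm.toMatrix_mul_basis_toMatrix b c B,
      scd_toMatrix_of_isOrthoFamily B c hc]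
  refine ⟨c.toMatrix b, fun i => B (c i) (c i), Matrix.isUnit_det_of_left_inverse hflip, ?_⟩
  calc ν = (b.toMatrix c * c.toMatrix b)ᵀ * ν * (b.toMatrix c * c.toMatrix b) := by
        rw [hflip, Matrix.transpose_one, Matrix.one_mul, Matrix.mul_one]
    _ = (c.toMatrix b)ᵀ * ((b.toMatrix c)ᵀ * ν * b.toMatrix c) * c.toMatrix b := by
        rw [Matrix.transpose_mul]
        simp only [Matrix.mul_assoc]
    _ = (c.toMatrix b)ᵀ * Matrix.diagonal (fun i => B (c i) (c i)) * c.toMatrix b := by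
        rw [hdiag]

end Summit.ValiantsHypothesis.ValiantsHypothesis.Theorems.SublinearShadowSketch
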